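import Summits.CriticalPhenomena.Ising3D.Control2DRhoEnvelopeSharp
import Summits.CriticalPhenomena.Ising3D.Control2DDiagonalStates
import Mathlib.Analysis.SpecialFunctions.Pow.Real
import Mathlib.Tactic.Linarith
import Mathlib.Tactic.Positivity
import Mathlib.Tactic.FieldSimp
import Mathlib.Tactic.Ring
import HarnessLib

/-!
# The `ρ`-states of the diagonal expansion: `G(z(ρ),z(ρ)) - 1 = Σ_{(i,n,n')} 2 p_i 4^{Δ_i} b_n(h_i) b_{n'}(h̄_i) ρ^{Δ_i+2n+2n'}` and the
# integrated weighted spectral density `F_ρ(E)` of the `ρ`-frame (Pappadopulo–Rychkov–Espin–Rattazzi 2012 §5), for the typed class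
(cell `pub-ising3x`, seat controls-1 gen 48; PAPER §6.2 / Appendix E — CONTROL-ONLY; part 1 of 2, part 2 is
`Control2DRhoDensityAsymptotics`; the `ρ`-frame twin of E.1u's `Control2DDiagonalStates`)

HONEST FRAMING: lottery ticket; floor = tightest certified 3D Ising CFT bounds; no exact-solution
claim without a proof. CONTROL-ONLY (`d = 2`, global `sl(2) × sl(2)` blocks, `Δ_σ = s` an INPUT, axiom set `A2D′`);
nothing here is about `d = 3`, no certificate, functional or number of the record is touched, and no new hypothesis or
named fact enters. Three DEFINITIONS are introduced (`rhoWeight`, `rhoLevel`, `rhoSpectralCount`), mirroring E.1u's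
`diagWeight`, `diagLevel`, `spectralCount`.

WHAT THIS FILE ADDS. Pappadopulo–Rychkov–Espin–Rattazzi 2012 §5 quantise radially: in the variable `ρ` (`z = 4ρ/(1+ρ)²`) the
correlator of a unitary CFT is a series `Σ_states λ ρ^{E}` with NON-NEGATIVE weights over ALL states, whence (their §5.2) the
density `F_ρ(E) ∼ (const)·E^{4Δ_φ}/Γ(4Δ_φ+1)` and the rate `|ρ|^{Δ_*}`. For the typed two-dimensional class the states are EXPLICIT
once the `ρ`-series of the blocks is known — and it is, by E.1z (`Control2DRhoExpansion`, `Control2DRhoEnvelopeSharp`):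
`k_{2h}(4ρ/(1+ρ)²) = Σ_n (4ρ)^h b_n(h) ρ^{2n}`, `b_n(h) = (½)_n(h)_n/(n!(h+½)_n) ≥ 0` (`hasSum_chiralBlock_rho`, `rhoCoeff_nonneg`), so on the
diagonal `g_{Δ,ℓ}(z,z) = 2k_{2h}(z)k_{2h̄}(z) = Σ_{n,n'} 2·4^Δ b_n(h)b_{n'}(h̄) ρ^{Δ+2n+2n'}` and
`G(z(ρ),z(ρ)) - 1 = Σ_{(i,n,n')} 2 p_i 4^{Δ_i} b_n(h_i) b_{n'}(h̄_i) ρ^{Δ_i+2n+2n'}`: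

* `CrossingData.rhoWeight D (i,n,n') = 2 p_i 4^{Δ_i} b_n(h_i) b_{n'}(h̄_i)`, `CrossingData.rhoLevel D (i,n,n') = Δ_i + 2n + 2n'`
  (`_nonneg` for unitary data); `hasSum_rhoStates_fiber` — one conformal family: `Σ_{(n,n')} w ρ^{level} = p_i g_i(z,z)`;
  **`hasSum_rhoStates (hU) (hconv)`** — `Σ_{(i,n,n')} w ρ^{level} = G(z,z) - 1` for `ρ ∈ (0,1)`, `z = 4ρ/(1+ρ)²` (non-negative family,
  fibrewise sums, `summable_prod_of_nonneg` + `HasSum.prod_fiberwise`); `hasSum_rhoLaplace` — the same at `ρ = e^{-t}`;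
* **`CrossingData.rhoSpectralCount D E := 1 + Σ'_{j : level_j ≤ E} w_j`** — the integrated weighted spectral density of the `ρ`-frame,
  the vacuum's unit weight included; `summable_rhoWeight_le`;
* `two_mul_tsum_p_four_rpow_le`, **`tsum_p_four_rpow_le_rhoSpectralCount`** — the quasi-primaries alone, in the `4^Δ` normalisation:
  `Σ'_{Δ_i ≤ E} p_i 4^{Δ_i} ≤ (F_ρ(E) - 1)/2` (the sub-family `(i,0,0)`, `b_0 = 1`).

NOT claimed: any asymptotics (part 2: no Tauberian statement here, no rate, no pointwise lower bound in `E` anywhere in #B); that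
these weights are norms of states of a CFT Hilbert space (they are DEFINED from the datum and the `ρ`-series of the closed-form
blocks); anything off the REAL diagonal; complex `ρ` / the cut plane; Korevaar's remainder; anything at `s = 0`; Virasoro; anything
three-dimensional; no number of the record touched.

References: D. Pappadopulo, S. Rychkov, J. Espin, R. Rattazzi, Phys. Rev. D 86 (2012) 105043, §5.1–§5.2
[cite: PappadopuloRychkovEspinRattazzi2012PRD, §5.2]; M. Hogervorst, S. Rychkov, Phys. Rev. D 87 (2013) 106004, §2
[cite: HogervorstRychkov2013, §2]. Tree: `hasSum_chiralBlock_rho`, `rhoCoeff_nonneg` (`Control2DRhoEnvelopeSharp`); `chiralBlock_eq_rho`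
(`Control2DRhoExpansion`); `summable_subtype_le_of_summable_exp`, `exp_neg_rpow` (`Control2DDiagonalStates`); `globalBlock`
(`Control2DBootstrap`); `fourPoint`, `OpeConvergent` (`Control2DFourPoint`); `four_mul_div_sq_mem_Ioo` (`Control2DRhoCoordinate`). Mathlib:
`HasSum.mul`, `Summable.mul_of_nonneg`, `summable_prod_of_nonneg`, `HasSum.prod_fiberwise`, `Summable.tsum_le_tsum_of_inj`,
`ordinaryHypergeometricCoefficient`.
-/

namespace Summit.CriticalPhenomena.Ising3D.Control2D

open Set Filter Topology
open Literature.MathematicalPhysics.QuantumFieldTheory.ConformalBootstrap3D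

namespace CrossingData

variable {D : CrossingData} {s : ℝ}

/-- **The weight of the `ρ`-state `(i, n, n')`**: `2 · p_i · 4^{Δ_i} · b_n(h_i) · b_{n'}(h̄_i)`, `h_i = (Δ_i + ℓ_i)/2`,
`h̄_i = (Δ_i - ℓ_i)/2`, `b_n(h) = (½)_n (h)_n/(n!(h+½)_n)` the `ρ`-coefficients of `k_{2h}(4ρ/(1+ρ)²) = (4ρ)^h Σ_n b_n(h) ρ^{2n}`
(`hasSum_chiralBlock_rho`; Mathlib's `ordinaryHypergeometricCoefficient (1/2) h (h+1/2) n`) — the `ρ`-frame analogue of E.1u's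
`diagWeight`, after Pappadopulo–Rychkov–Espin–Rattazzi 2012 §5 (radial quantisation: the correlator as a positive series in `ρ`).
[cite: PappadopuloRychkovEspinRattazzi2012PRD, §5.2] -/
noncomputable def rhoWeight (D : CrossingData) (j : D.ι × ℕ × ℕ) : ℝ :=
  2 * D.p j.1 * (4 : ℝ) ^ D.Δ j.1 *
    (ordinaryHypergeometricCoefficient (1 / 2 : ℝ) ((D.Δ j.1 + D.spin j.1) / 2) ((D.Δ j.1 + D.spin j.1) / 2 + 1 / 2) j.2.1 *
      ordinaryHypergeometricCoefficient (1 / 2 : ℝ) ((D.Δ j.1 - D.spin j.1) / 2) ((D.Δ j.1 - D.spin j.1) / 2 + 1 / 2) j.2.2)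

/-- **The level of the `ρ`-state `(i, n, n')`**: `Δ_i + 2n + 2n'` (the `ρ`-series of each chiral block runs over even powers).
[cite: PappadopuloRychkovEspinRattazzi2012PRD, §5.2] -/
noncomputable def rhoLevel (D : CrossingData) (j : D.ι × ℕ × ℕ) : ℝ :=
  D.Δ j.1 + 2 * (j.2.1 : ℝ) + 2 * (j.2.2 : ℝ)

/-- **The integrated weighted spectral density in the `ρ`-frame**: `F_ρ(E) = 1 + Σ'_{(i,n,n') : Δ_i + 2n + 2n' ≤ E} 2 p_i 4^{Δ_i} b_n b_{n'}`
— the total `ρ`-expansion weight of `G(z(ρ),z(ρ)) = 1 + Σ w ρ^{level}` at levels `≤ E`, the vacuum's unit weight included (an unconditional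
`tsum`; the sub-family is summable for OPE-convergent data, `summable_rhoWeight_le`). [cite: PappadopuloRychkovEspinRattazzi2012PRD, §5.2] -/
noncomputable def rhoSpectralCount (D : CrossingData) (E : ℝ) : ℝ :=
  1 + ∑' j : ↥({j : D.ι × ℕ × ℕ | D.rhoLevel j ≤ E} : Set (D.ι × ℕ × ℕ)), D.rhoWeight j

/-- The `ρ`-weights are `≥ 0` for unitary data (`p_i ≥ 0`, `b_n(h) ≥ 0` for `h ≥ 0`, `rhoCoeff_nonneg`). [folklore] -/
theorem rhoWeight_nonneg (hU : D.IsUnitary) (j : D.ι × ℕ × ℕ) : 0 ≤ D.rhoWeight j := by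
  have hℓ : (0 : ℝ) ≤ D.spin j.1 := Nat.cast_nonneg _
  have h1 := (hU j.1).2.1
  unfold rhoWeight
  exact mul_nonneg (mul_nonneg (mul_nonneg (by norm_num) (hU j.1).2.2) (Real.rpow_nonneg (by norm_num) _))
    (mul_nonneg (rhoCoeff_nonneg (by linarith) _) (rhoCoeff_nonneg (by linarith) _))

/-- The `ρ`-levels are `≥ 0` for unitary data (`Δ_i ≥ ℓ_i ≥ 0`). [folklore] -/
theorem rhoLevel_nonneg (hU : D.IsUnitary) (j : D.ι × ℕ × ℕ) : 0 ≤ D.rhoLevel j := by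
  have hℓ : (0 : ℝ) ≤ D.spin j.1 := Nat.cast_nonneg _
  have h1 := (hU j.1).2.1
  have h2 : (0 : ℝ) ≤ j.2.1 := Nat.cast_nonneg _
  have h3 : (0 : ℝ) ≤ j.2.2 := Nat.cast_nonneg _
  unfold rhoLevel
  linarith

/-- **One conformal family in the `ρ`-frame**: for a unitary label `i` and `ρ ∈ (0,1)`,
`Σ_{(n,n')} 2 p_i 4^{Δ_i} b_n(h_i) b_{n'}(h̄_i) ρ^{Δ_i+2n+2n'} = p_i g_i(z,z)` at `z = 4ρ/(1+ρ)²` (`hasSum_chiralBlock_rho` for the two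
weights, multiplied: `g_{Δ,ℓ}(z,z) = 2 k_{2h}(z) k_{2h̄}(z)` on the diagonal). [cite: HogervorstRychkov2013, §2] -/
theorem hasSum_rhoStates_fiber (hU : D.IsUnitary) (i : D.ι) {ρ : ℝ} (hρ : ρ ∈ Ioo (0 : ℝ) 1) :
    HasSum (fun nn : ℕ × ℕ => D.rhoWeight (i, nn) * ρ ^ D.rhoLevel (i, nn))
      (D.p i * globalBlock (D.Δ i) (D.spin i) (4 * ρ / (1 + ρ) ^ 2) (4 * ρ / (1 + ρ) ^ 2)) := by
  have hℓ : (0 : ℝ) ≤ D.spin i := Nat.cast_nonneg _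
  have hΔ := (hU i).2.1
  set h₁ : ℝ := (D.Δ i + D.spin i) / 2 with hh₁
  set h₂ : ℝ := (D.Δ i - D.spin i) / 2 with hh₂
  have hh₁0 : 0 ≤ h₁ := by rw [hh₁]; linarith
  have hh₂0 : 0 ≤ h₂ := by rw [hh₂]; linarith
  have H1 := hasSum_chiralBlock_rho hh₁0 hρ
  have H2 := hasSum_chiralBlock_rho hh₂0 hρ
  have h4ρ : 0 < 4 * ρ := by linarith [hρ.1]
  have hx0 : 0 ≤ ρ ^ 2 := sq_nonneg ρ
  have P := H1.mul H2 (H1.summable.mul_of_nonneg H2.summable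
    (fun n => mul_nonneg (Real.rpow_nonneg h4ρ.le _) (mul_nonneg (rhoCoeff_nonneg hh₁0 n) (pow_nonneg hx0 n)))
    (fun n => mul_nonneg (Real.rpow_nonneg h4ρ.le _) (mul_nonneg (rhoCoeff_nonneg hh₂0 n) (pow_nonneg hx0 n))))
  have P2 := P.mul_left (2 * D.p i)
  have hval : 2 * D.p i * (chiralBlock h₁ (4 * ρ / (1 + ρ) ^ 2) * chiralBlock h₂ (4 * ρ / (1 + ρ) ^ 2)) =
      D.p i * globalBlock (D.Δ i) (D.spin i) (4 * ρ / (1 + ρ) ^ 2) (4 * ρ / (1 + ρ) ^ 2) := by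
    unfold globalBlock; rw [← hh₁, ← hh₂]; ring
  rw [hval] at P2
  refine P2.congr_fun fun nn => ?_
  -- `(4ρ)^{h₁} (4ρ)^{h₂} (ρ²)^n (ρ²)^{n'} = 4^{Δ} ρ^{Δ + 2n + 2n'}`
  have e1 : (4 * ρ) ^ h₁ * (4 * ρ) ^ h₂ = (4 : ℝ) ^ D.Δ i * ρ ^ D.Δ i := by
    rw [← Real.rpow_add h4ρ, show h₁ + h₂ = D.Δ i by rw [hh₁, hh₂]; ring, Real.mul_rpow (by norm_num) hρ.1.le]
  have e2 : ρ ^ D.Δ i * (ρ ^ 2) ^ nn.1 * (ρ ^ 2) ^ nn.2 = ρ ^ D.rhoLevel (i, nn) := by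
    unfold rhoLevel
    rw [Real.rpow_add hρ.1, Real.rpow_add hρ.1, ← pow_mul, ← pow_mul,
      show (2 : ℝ) * (nn.1 : ℝ) = ((2 * nn.1 : ℕ) : ℝ) by push_cast; ring,
      show (2 : ℝ) * (nn.2 : ℝ) = ((2 * nn.2 : ℕ) : ℝ) by push_cast; ring, Real.rpow_natCast, Real.rpow_natCast]
  show D.rhoWeight (i, nn) * ρ ^ D.rhoLevel (i, nn) =
    2 * D.p i * ((4 * ρ) ^ h₁ * (ordinaryHypergeometricCoefficient (1 / 2 : ℝ) h₁ (h₁ + 1 / 2) nn.1 * (ρ ^ 2) ^ nn.1) *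
      ((4 * ρ) ^ h₂ * (ordinaryHypergeometricCoefficient (1 / 2 : ℝ) h₂ (h₂ + 1 / 2) nn.2 * (ρ ^ 2) ^ nn.2)))
  unfold rhoWeight
  dsimp only
  rw [← hh₁, ← hh₂, ← e2]
  linear_combination (-(2 * D.p i *
    (ordinaryHypergeometricCoefficient (1 / 2 : ℝ) h₁ (h₁ + 1 / 2) nn.1 *
      ordinaryHypergeometricCoefficient (1 / 2 : ℝ) h₂ (h₂ + 1 / 2) nn.2) * (ρ ^ 2) ^ nn.1 * (ρ ^ 2) ^ nn.2)) * e1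

/-- **The diagonal expansion as a sum over `ρ`-states**: for a unitary datum whose expansion converges on the open square and
`ρ ∈ (0,1)`, `Σ_{(i,n,n')} 2 p_i 4^{Δ_i} b_n(h_i) b_{n'}(h̄_i) ρ^{Δ_i+2n+2n'} = G(z,z) - 1` at `z = 4ρ/(1+ρ)²` (non-negative family;
fibrewise sums `p_i g_i(z,z)`; `summable_prod_of_nonneg` + `HasSum.prod_fiberwise`, as E.1u's `hasSum_diagStates`).
[cite: PappadopuloRychkovEspinRattazzi2012PRD, §5.2] -/
theorem hasSum_rhoStates (hU : D.IsUnitary) (hconv : D.OpeConvergent) {ρ : ℝ} (hρ : ρ ∈ Ioo (0 : ℝ) 1) :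
    HasSum (fun j : D.ι × ℕ × ℕ => D.rhoWeight j * ρ ^ D.rhoLevel j)
      (D.fourPoint (4 * ρ / (1 + ρ) ^ 2) (4 * ρ / (1 + ρ) ^ 2) - 1) := by
  have hz := four_mul_div_sq_mem_Ioo hρ
  set x : ℝ := 4 * ρ / (1 + ρ) ^ 2 with hx
  set f : D.ι × ℕ × ℕ → ℝ := fun j => D.rhoWeight j * ρ ^ D.rhoLevel j with hf
  have hf0 : 0 ≤ f := fun j => mul_nonneg (rhoWeight_nonneg hU j) (Real.rpow_nonneg hρ.1.le _)
  have hfib : ∀ i, HasSum (fun nn : ℕ × ℕ => f (i, nn)) (D.p i * globalBlock (D.Δ i) (D.spin i) x x) :=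
    fun i => hasSum_rhoStates_fiber hU i hρ
  have hS : Summable f := by
    refine (summable_prod_of_nonneg hf0).mpr ⟨fun i => (hfib i).summable, ?_⟩
    have : (fun i => ∑' nn : ℕ × ℕ, f (i, nn)) = fun i => D.p i * globalBlock (D.Δ i) (D.spin i) x x :=
      funext fun i => (hfib i).tsum_eq
    rw [this]
    exact hconv x x hz hz
  have h1 : HasSum (fun i => D.p i * globalBlock (D.Δ i) (D.spin i) x x) (∑' j, f j) :=
    hS.hasSum.prod_fiberwise hfib
  have h2 : ∑' j, f j = D.fourPoint x x - 1 := by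
    rw [← h1.tsum_eq]
    unfold fourPoint
    ring
  rw [← h2]
  exact hS.hasSum

/-- **The Laplace form in the `ρ`-frame** (`ρ = e^{-t}`): for a unitary OPE-convergent datum and `t > 0`,
`Σ_{(i,n,n')} w e^{-t·level} = G(z(e^{-t}),z(e^{-t})) - 1`. [cite: PappadopuloRychkovEspinRattazzi2012PRD, §5.2] -/
theorem hasSum_rhoLaplace (hU : D.IsUnitary) (hconv : D.OpeConvergent) {t : ℝ} (ht : 0 < t) :
    HasSum (fun j : D.ι × ℕ × ℕ => D.rhoWeight j * Real.exp (-(t * D.rhoLevel j)))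
      (D.fourPoint (4 * Real.exp (-t) / (1 + Real.exp (-t)) ^ 2) (4 * Real.exp (-t) / (1 + Real.exp (-t)) ^ 2) - 1) := by
  have hx : Real.exp (-t) ∈ Ioo (0 : ℝ) 1 := ⟨Real.exp_pos _, Real.exp_lt_one_iff.mpr (by linarith)⟩
  refine (hasSum_rhoStates hU hconv hx).congr_fun fun j => ?_
  rw [exp_neg_rpow]

/-- The `ρ`-states below any level carry finite total weight (OPE-convergent unitary data). [folklore] -/
theorem summable_rhoWeight_le (hU : D.IsUnitary) (hconv : D.OpeConvergent) (E : ℝ) :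
    Summable fun j : ↥({j : D.ι × ℕ × ℕ | D.rhoLevel j ≤ E} : Set (D.ι × ℕ × ℕ)) => D.rhoWeight j :=
  summable_subtype_le_of_summable_exp (rhoWeight_nonneg hU) (hasSum_rhoLaplace hU hconv one_pos).summable E

/-! ### The primaries alone, in the `4^Δ` normalisation -/

/-- **The quasi-primaries below `E` carry at most half the `ρ`-weight of the `ρ`-states below `E`**:
`2·Σ'_{Δ_i ≤ E} p_i 4^{Δ_i} ≤ Σ'_{level ≤ E} w` (the sub-family `(i,0,0)`, `b_0 = 1`). [folklore] -/
theorem two_mul_tsum_p_four_rpow_le (hU : D.IsUnitary) (hconv : D.OpeConvergent) (E : ℝ) :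
    2 * ∑' i : ↥({i : D.ι | D.Δ i ≤ E} : Set D.ι), D.p i * (4 : ℝ) ^ D.Δ (i : D.ι) ≤
      ∑' j : ↥({j : D.ι × ℕ × ℕ | D.rhoLevel j ≤ E} : Set (D.ι × ℕ × ℕ)), D.rhoWeight j := by
  rw [← tsum_mul_left]
  let e : ↥({i : D.ι | D.Δ i ≤ E} : Set D.ι) → ↥({j : D.ι × ℕ × ℕ | D.rhoLevel j ≤ E} : Set (D.ι × ℕ × ℕ)) :=
    fun i => ⟨((i : D.ι), 0, 0), by
      show D.rhoLevel ((i : D.ι), 0, 0) ≤ E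
      simp only [rhoLevel, Nat.cast_zero, mul_zero, add_zero]
      exact i.2⟩
  have he : Function.Injective e := by
    intro a b hab
    have h1 := congrArg (fun j : ↥({j : D.ι × ℕ × ℕ | D.rhoLevel j ≤ E} : Set (D.ι × ℕ × ℕ)) =>
      (j : D.ι × ℕ × ℕ).1) hab
    exact Subtype.ext h1
  have hg := summable_rhoWeight_le hU hconv E
  have hval : ∀ i : ↥({i : D.ι | D.Δ i ≤ E} : Set D.ι),
      2 * (D.p (i : D.ι) * (4 : ℝ) ^ D.Δ (i : D.ι)) =
        D.rhoWeight ((e i : ↥({j : D.ι × ℕ × ℕ | D.rhoLevel j ≤ E} : Set _)) : D.ι × ℕ × ℕ) :=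
    fun i => by
      show 2 * (D.p (i : D.ι) * (4 : ℝ) ^ D.Δ (i : D.ι)) = D.rhoWeight ((i : D.ι), 0, 0)
      simp only [rhoWeight, ordinaryHypergeometricCoefficient, Nat.factorial_zero, Nat.cast_one, inv_one,
        ascPochhammer_zero, Polynomial.eval_one, mul_one]
      ring
  have hf : Summable fun i : ↥({i : D.ι | D.Δ i ≤ E} : Set D.ι) => 2 * (D.p i * (4 : ℝ) ^ D.Δ (i : D.ι)) :=
    (hg.comp_injective he).congr fun i => (hval i).symm
  exact Summable.tsum_le_tsum_of_inj e he (fun c _ => rhoWeight_nonneg hU c) (fun i => (hval i).le) hf hg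

/-- `Σ'_{Δ_i ≤ E} p_i 4^{Δ_i} ≤ (F_ρ(E) - 1)/2`. [folklore] -/
theorem tsum_p_four_rpow_le_rhoSpectralCount (hU : D.IsUnitary) (hconv : D.OpeConvergent) (E : ℝ) :
    ∑' i : ↥({i : D.ι | D.Δ i ≤ E} : Set D.ι), D.p i * (4 : ℝ) ^ D.Δ (i : D.ι) ≤ (D.rhoSpectralCount E - 1) / 2 := by
  have h := two_mul_tsum_p_four_rpow_le hU hconv E
  rw [rhoSpectralCount]
  linarith

end CrossingData

end Summit.CriticalPhenomena.Ising3D.Control2D
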